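import Mathlib
import Summits.KontsevichZagierPeriods.Zeta5Search.DenomLaw.LongProfiles15Path
import Summits.KontsevichZagierPeriods.Zeta5Search.DenomLaw.LongProfilesDeepPath
import HarnessLib

/-!
# ζ(5) search — PATH ACCOUNTING FOR EVERY SORTED PARAMETER VECTOR ON THE FOURTEEN LONGEST FIRST-PERIOD PROFILES (`N_p ≥ 15`) WITH NO DEPTH HYPOTHESIS (DENOM-LAW D1, prover-d1 gen 22)

Cell `pub-zeta5` (HONEST FRAMING: systematic search; no irrationality claim unless certified), TRACK «DENOM-LAW» D1 prover seat (denom-prover-d1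
gen 22, `HOME/denom-law/prover-d1/ATTEMPT-22.md` §2).  Gen 18's one-statement assembly `FullProfile.pathAccountingFirstPeriod_long15` — the ∀-`b`
node `DenomLaw.PathAccountingFirstPeriod` for every sorted `b` with all seven parameters and at least fifteen pair blocks reaching `p` — carried two DEPTH
hypotheses, `d(b) < 4p` and «`d(b) < 3p` whenever `b₀ − b₁ − b₅ < p`», which excluded exactly the four cells closed by gen 22's `DenomLaw/LongProfilesDeepPath`
(the full profile's corner `4p ≤ d`; the branches `(1,2),…,(1,5)` / `…,(1,6)` / `…,(1,7)` at `3p ≤ d`).  This file removes both: `d ≥ 4p` forces the full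
profile (if `b₀ − b₁ − b₂ < p` then `d = (b₀−b₁−b₂) + (b₀−b₃−b₄) + (b₀−b₅−b₆) − b₇ < p + 2p + 2p − p`), and `b₀ − b₁ − b₅ < p ≤ d/3` forces one of the three
branches through the largest parameter with `b₀ − b₂ − b₃ ≥ p` (if `b₀ − b₂ − b₃ < p` as well then `d = (b₀−b₂−b₃) + (b₀−b₁−b₄) + (b₀−b₅−b₆) − b₇ < 3p`),
which split by `b₀ − b₁ − b₆`, `b₀ − b₁ − b₇`.  Result: **`pathAccounting_long15_all`** (every `j`) and **`pathAccountingFirstPeriod_long15_all`**: the node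
with its binders VERBATIM plus `p ≤ b₇` and the `N_p ≥ 15` disjunction ONLY — Brown–Zudilin's prime-by-prime accounting (28)+(30), Casoratian form, on the
fourteen longest profiles of the first period of EVERY direction of the polytope, all depths.  Assembly only; no new valuation argument.
MODEL/structure-side valuation bookkeeping of the cell's own rationals; nothing about ζ(5); no γ; records in print UNMOVED.
-/

namespace Summit.KontsevichZagierPeriods.Zeta5Search.FullProfile

open Summit.KontsevichZagierPeriods.Zeta5Search.CasoratianValuation (InPolytope shift casoratian pairFloors refund)
open Summit.KontsevichZagierPeriods.Zeta5Search.WedgeDictionary (dOf)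
open Summit.KontsevichZagierPeriods.Zeta5Search.DenomLaw (cStar FirstPeriod Sorted7)
open Summit.KontsevichZagierPeriods.Zeta5Search.DenomLaw.FirstPeriodKit (sorted7_chain firstPeriod_pair)

/-- **`PathAccountingFirstPeriod`'s conclusion for EVERY sorted `b` on the profiles `N_p ≥ 15`, every direction `j`, EVERY depth `d`**: all seven parameters
reach `p` and at least 15 pair blocks reach `p` (`b₀−b₂−b₃ ≥ p`, or `b₀−b₁−b₇, b₀−b₂−b₄ ≥ p`, or `b₀−b₁−b₆, b₀−b₂−b₅, b₀−b₃−b₄ ≥ p`, or `b₀−b₁−b₅ ≥ p`). -/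
theorem pathAccounting_long15_all (b : ℕ → ℤ) (j p : ℕ) (hb : InPolytope b) (hs : Sorted7 b) (hbj : InPolytope (shift b j))
    (hj1 : 1 ≤ j) (hj7 : j ≤ 7) (hprime : p.Prime) (hp5 : 5 ≤ p) (hwin : (b 0 + 2 : ℤ) < (p : ℤ) ^ 2) (hfp : FirstPeriod b p)
    (hP : (p : ℤ) ≤ b 7)
    (hor : (p : ℤ) + b 2 + b 3 ≤ b 0 ∨ ((p : ℤ) + b 1 + b 7 ≤ b 0 ∧ (p : ℤ) + b 2 + b 4 ≤ b 0) ∨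
      ((p : ℤ) + b 1 + b 6 ≤ b 0 ∧ (p : ℤ) + b 2 + b 5 ≤ b 0 ∧ (p : ℤ) + b 3 + b 4 ≤ b 0) ∨ (p : ℤ) + b 1 + b 5 ≤ b 0)
    (hcas : casoratian b j ≠ 0) :
    dOf b / (p : ℤ) - pairFloors b p - min (if 2 ≤ dOf b / (p : ℤ) then (1 : ℤ) else 0) (5 - (cStar b p : ℤ))
      ≤ padicValRat p (casoratian b j) := by
  obtain ⟨h21, h32, h43, h54, h65, h76⟩ := sorted7_chain hs
  have hF34 := firstPeriod_pair hfp (i := 2) (k := 3) (by norm_num) (by norm_num) (by norm_num)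
  have hF56 := firstPeriod_pair hfp (i := 4) (k := 5) (by norm_num) (by norm_num) (by norm_num)
  have hF14 := firstPeriod_pair hfp (i := 0) (k := 3) (by norm_num) (by norm_num) (by norm_num)
  have hF46 := firstPeriod_pair hfp (i := 3) (k := 5) (by norm_num) (by norm_num) (by norm_num)
  simp only [Nat.reduceAdd] at hF34 hF56 hF14 hF46
  have hd := DecompositionWholeCone.dOf_expand b
  by_cases hd4 : dOf b < 4 * (p : ℤ)
  · by_cases hd3 : b 0 < (p : ℤ) + b 1 + b 5 → dOf b < 3 * (p : ℤ)
    · exact pathAccounting_long15 b j p hb hs hbj hj1 hj7 hprime hp5 hwin hfp hP hor hd4 hd3 hcas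
    · -- `b₀ − b₁ − b₅ < p` and `3p ≤ d`: then `b₀ − b₂ − b₃ ≥ p` (else `d < 3p`), and the branch is `(1,5)`, `(1,6)` or `(1,7)`
      push Not at hd3
      obtain ⟨h15, hd3⟩ := hd3
      have h23 : (p : ℤ) + b 2 + b 3 ≤ b 0 := by
        by_contra h
        push Not at h
        linarith
      by_cases h16 : (p : ℤ) + b 1 + b 6 ≤ b 0
      · exact pathAccounting_profile17a_all b j p hb hs hbj hj1 hj7 hprime hp5 hwin hfp hP h15 h16 h23 hcas
      push Not at h16
      by_cases h17 : (p : ℤ) + b 1 + b 7 ≤ b 0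
      · exact pathAccounting_profile16a_all b j p hb hs hbj hj1 hj7 hprime hp5 hwin hfp hP h16 h17 h23 hcas
      push Not at h17
      exact pathAccounting_profile15a_all b j p hb hs hbj hj1 hj7 hprime hp5 hwin hfp hP h17 h23 hcas
  · -- `4p ≤ d` forces the full profile
    push Not at hd4
    have h12 : (p : ℤ) + b 1 + b 2 ≤ b 0 := by
      by_contra h
      push Not at h
      linarith
    exact pathAccounting_fullProfile_all b j p hb hs hbj hj1 hj7 hprime hp5 hwin hfp hP h12 hcas

/-- **THE NODE FOR EVERY SORTED `b` ON THE PROFILES `N_p ≥ 15`, EVERY DEPTH: `PathAccountingFirstPeriod` with its binders VERBATIM plus `p ≤ b₇` and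
(`p + b₂ + b₃ ≤ b₀` ∨ (`p + b₁ + b₇ ≤ b₀ ∧ p + b₂ + b₄ ≤ b₀`) ∨ (`p + b₁ + b₆ ≤ b₀ ∧ p + b₂ + b₅ ≤ b₀ ∧ p + b₃ + b₄ ≤ b₀`) ∨ `p + b₁ + b₅ ≤ b₀`) — all parameters
and at least fifteen pair blocks reach `p` — and NOTHING on `d(b)`.** -/
theorem pathAccountingFirstPeriod_long15_all :
    ∀ (b : ℕ → ℤ) (p : ℕ), InPolytope b → Sorted7 b → InPolytope (shift b 7) →
      p.Prime → 5 ≤ p → (b 0 + 2 : ℤ) < (p : ℤ) ^ 2 → FirstPeriod b p → (p : ℤ) ≤ b 7 →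
      ((p : ℤ) + b 2 + b 3 ≤ b 0 ∨ ((p : ℤ) + b 1 + b 7 ≤ b 0 ∧ (p : ℤ) + b 2 + b 4 ≤ b 0) ∨
        ((p : ℤ) + b 1 + b 6 ≤ b 0 ∧ (p : ℤ) + b 2 + b 5 ≤ b 0 ∧ (p : ℤ) + b 3 + b 4 ≤ b 0) ∨ (p : ℤ) + b 1 + b 5 ≤ b 0) →
      casoratian b 7 ≠ 0 →
        dOf b / (p : ℤ) - pairFloors b p - min (if 2 ≤ dOf b / (p : ℤ) then (1 : ℤ) else 0) (5 - (cStar b p : ℤ))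
          ≤ padicValRat p (casoratian b 7) :=
  fun b p hb hs hb7 hprime hp5 hwin hfp hP hor hcas =>
    pathAccounting_long15_all b 7 p hb hs hb7 (by norm_num) (by norm_num) hprime hp5 hwin hfp hP hor hcas

/-- **(CV) for every sorted `b` on the profiles `N_p ≥ 15`, every `j`, every depth** (the (CV) value `refund − N_p` never exceeds the PATH value). -/
theorem long15CV_all (b : ℕ → ℤ) (j p : ℕ) (hb : InPolytope b) (hs : Sorted7 b) (hbj : InPolytope (shift b j))
    (hj1 : 1 ≤ j) (hj7 : j ≤ 7) (hprime : p.Prime) (hp5 : 5 ≤ p) (hwin : (b 0 + 2 : ℤ) < (p : ℤ) ^ 2) (hfp : FirstPeriod b p)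
    (hP : (p : ℤ) ≤ b 7)
    (hor : (p : ℤ) + b 2 + b 3 ≤ b 0 ∨ ((p : ℤ) + b 1 + b 7 ≤ b 0 ∧ (p : ℤ) + b 2 + b 4 ≤ b 0) ∨
      ((p : ℤ) + b 1 + b 6 ≤ b 0 ∧ (p : ℤ) + b 2 + b 5 ≤ b 0 ∧ (p : ℤ) + b 3 + b 4 ≤ b 0) ∨ (p : ℤ) + b 1 + b 5 ≤ b 0)
    (hcas : casoratian b j ≠ 0) : refund b p - pairFloors b p ≤ padicValRat p (casoratian b j) := by
  linarith [StairTS3.refund_le_pathHead b p (5 - (cStar b p : ℤ)),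
    pathAccounting_long15_all b j p hb hs hbj hj1 hj7 hprime hp5 hwin hfp hP hor hcas]

end Summit.KontsevichZagierPeriods.Zeta5Search.FullProfile
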